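import Literature.NumberTheory.BeurlingPrimes.EulerProduct
import Literature.NumberTheory.BeurlingPrimes.IntCountBasic
import Mathlib.MeasureTheory.Constructions.BorelSpace.Order
import Mathlib.Analysis.PSeries
import HarnessLib

/-!
# Hilberdink's uncertainty principle, I: counting functions and convergence of `ζ_P` from `N_P(x) ≪ x`

Topic `Literature/NumberTheory/BeurlingPrimes`, grouping namespace `Hilberdink` (the files
`Hilberdink*.lean` formalise T. W. Hilberdink, *Well-behaved Beurling primes and integers*, JNT 2005,
Theorem 1: `max{α, β} ≥ 1/2` for every `[α, β]`-system, vendored as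
`Literature.Barriers.RiemannHypothesis.Hilberdink2005_thm1`). Everything in this file is PROVED. It is
the bookkeeping layer, for the Beurling systems `P : BeurlingPrimes` of the Barriers file (`genInt`,
`intCount = N_P`, `chebyshevPsi = ψ_P`), on top of the tree's `IntCountBasic.lean`
(`finite_setOf_genInt_le`, `intCount_mono`, …) and `MergePowers.lean` (`ψ_P` as a finite sum):

* `Hilberdink.intFinset P x` — the finite set `{k : genInt k ≤ x}` as a `Finset`, with
  `intCount x = #intFinset x` (`intCount_eq_card`); `N_P` (as a real function) is monotone and
  measurable; `N_P(λ_j) ≥ j + 1` (`succ_le_intCount_prime`); the indicator family over all exponent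
  vectors has sum `N_P(x)` (`hasSum_indicator_intCount`, the form used for Fubini);
* `Hilberdink.summable_prime_rpow` — if `N_P(x) ≤ Bx` (`x ≥ 1`) then `∑_j λ_j^{−σ} < ∞` for
  every `σ > 1` (since `j + 1 ≤ N_P(λ_j) ≤ Bλ_j`), which is the hypothesis of the tree's
  Euler-product file (`BeurlingPrimes.hasSum_zeta`, `zeta_eq_exp_tsum`);
  `Hilberdink.summable_primePow_rpow` — also `∑_{j,m} log λ_j · λ_j^{−(m+1)σ} < ∞`
  (absolute convergence of the Dirichlet series of `−ζ_P'/ζ_P`).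

These are the routine facts used without comment in Hilberdink–Lapidus 2006, §1.1 ("We are
generally interested in those systems for which `π_P(x) = O(x^A)` … the series `∑ p^{−s}`
converges in a half-plane") and Hilberdink 2005, §1.

## References
* [Hilberdink2005] T. W. Hilberdink, *Well-behaved Beurling primes and integers*, J. Number Theory
  112 (2005) 332–344, §1–2.
* T. W. Hilberdink, M. L. Lapidus, *Beurling zeta functions, generalised primes, and fractal
  membranes*, Acta Appl. Math. 94 (2006) 21–48, arXiv:math/0410270, §1.1, §2.1, §2.3.
-/

noncomputable section

open Set Filter

namespace Literature.NumberTheory.BeurlingPrimes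

open Literature.Barriers.RiemannHypothesis

namespace Hilberdink

variable (P : BeurlingPrimes)

/-! ### Generalized integers below `x` as a `Finset` -/

/-- The finite set of exponent vectors `k` with `genInt k ≤ x` (tree: `finite_setOf_genInt_le`).
[folklore] -/
def intFinset (x : ℝ) : Finset (ℕ →₀ ℕ) :=
  (P.finite_setOf_genInt_le x).toFinset

/-- Membership in `intFinset`. [folklore] -/
@[simp] theorem mem_intFinset {x : ℝ} {k : ℕ →₀ ℕ} : k ∈ intFinset P x ↔ P.genInt k ≤ x := by
  rw [intFinset, Set.Finite.mem_toFinset, mem_setOf_eq]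

/-- **`N_P(x) = #intFinset x`.** [folklore] -/
theorem intCount_eq_card (x : ℝ) : P.intCount x = (intFinset P x).card := by
  rw [P.intCount_eq_ncard, intFinset, ← Set.ncard_eq_toFinset_card _ (P.finite_setOf_genInt_le x)]

/-- `intFinset` is monotone in `x`. [folklore] -/
theorem intFinset_mono {x y : ℝ} (h : x ≤ y) : intFinset P x ⊆ intFinset P y :=
  fun _ hk ↦ (mem_intFinset P).mpr (((mem_intFinset P).mp hk).trans h)

/-- `N_P`, as a real function, is monotone. [folklore] -/
theorem monotone_intCount_real : Monotone fun x ↦ (P.intCount x : ℝ) :=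
  fun _ _ h ↦ Nat.cast_le.mpr (P.intCount_mono h)

/-- `N_P` is (Borel) measurable. [folklore] -/
theorem measurable_intCount_real : Measurable fun x ↦ (P.intCount x : ℝ) :=
  (monotone_intCount_real P).measurable

/-- `intFinset x = ∅` for `x < 1`. [folklore] -/
theorem intFinset_eq_empty {x : ℝ} (hx : x < 1) : intFinset P x = ∅ := by
  ext k
  simp only [mem_intFinset, Finset.notMem_empty, iff_false, not_le]
  exact hx.trans_le (P.one_le_genInt k)

/-- **`j + 1 ≤ N_P(λ_j)`**: the g-integers `λ_0, …, λ_j` are `≤ λ_j`. [folklore] -/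
theorem succ_le_intCount_prime (j : ℕ) : j + 1 ≤ P.intCount (P.prime j) := by
  classical
  rw [intCount_eq_card P]
  have hinj : Function.Injective fun i : ℕ ↦ Finsupp.single i (1 : ℕ) :=
    Finsupp.single_left_injective one_ne_zero
  calc j + 1 = ((Finset.range (j + 1)).image fun i ↦ Finsupp.single i (1 : ℕ)).card := by
        rw [Finset.card_image_of_injective _ hinj, Finset.card_range]
    _ ≤ (intFinset P (P.prime j)).card := by
        refine Finset.card_le_card fun k hk ↦ ?_
        obtain ⟨i, hi, rfl⟩ := Finset.mem_image.mp hk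
        rw [mem_intFinset, P.genInt_single, pow_one]
        exact P.mono (Nat.lt_succ_iff.mp (Finset.mem_range.mp hi))

/-- The indicator family over all exponent vectors has sum `N_P(x) • c` (`HasSum` over the finite
support). [folklore] -/
theorem hasSum_indicator_intCount {M : Type*} [AddCommMonoid M] [TopologicalSpace M] (x : ℝ) (c : M) :
    HasSum (fun k : ℕ →₀ ℕ ↦ if P.genInt k ≤ x then c else 0) ((P.intCount x) • c) := by
  classical
  have hsum : ∑ k ∈ intFinset P x, (if P.genInt k ≤ x then c else 0) = (P.intCount x) • c := by
    rw [Finset.sum_congr rfl (fun k hk ↦ if_pos ((mem_intFinset P).mp hk)), Finset.sum_const,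
      ← intCount_eq_card P]
  rw [← hsum]
  exact hasSum_sum_of_ne_finset_zero fun k hk ↦ if_neg fun h ↦ hk ((mem_intFinset P).mpr h)

/-- The number of g-integers in `(x, y]` is `N_P(y) − N_P(x)`, as the cardinality of a filter of
`intFinset y` (`x ≤ y`). [folklore] -/
theorem card_filter_lt_genInt {x y : ℝ} (hxy : x ≤ y) :
    ((intFinset P y).filter fun k ↦ x < P.genInt k).card = P.intCount y - P.intCount x := by
  classical
  rw [intCount_eq_card P, intCount_eq_card P]
  have hsub : intFinset P x ⊆ intFinset P y := intFinset_mono P hxy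
  have heq : (intFinset P y).filter (fun k ↦ x < P.genInt k) = intFinset P y \ intFinset P x := by
    ext k
    simp only [Finset.mem_filter, Finset.mem_sdiff, mem_intFinset, not_le]
  rw [heq, Finset.card_sdiff_of_subset hsub]

/-- `ψ_P` is measurable (it is monotone, `BeurlingPrimes.chebyshevPsi_mono`). [folklore] -/
theorem measurable_chebyshevPsi : Measurable P.chebyshevPsi :=
  P.chebyshevPsi_mono.measurable

/-! ### Convergence from `N_P(x) ≤ Bx` -/

/-- If `N_P(x) ≤ Bx` for `x ≥ 1` then `j + 1 ≤ B λ_j`. [folklore] -/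
theorem succ_le_mul_prime {B : ℝ} (hB : ∀ x : ℝ, 1 ≤ x → (P.intCount x : ℝ) ≤ B * x) (j : ℕ) :
    (j : ℝ) + 1 ≤ B * P.prime j := by
  have h := hB (P.prime j) (P.one_lt_prime j).le
  have h2 : ((j + 1 : ℕ) : ℝ) ≤ (P.intCount (P.prime j) : ℝ) := Nat.cast_le.mpr (succ_le_intCount_prime P j)
  push_cast at h2
  linarith

/-- The constant `B` in `N_P(x) ≤ Bx` is positive. [folklore] -/
theorem pos_of_intCount_le {B : ℝ} (hB : ∀ x : ℝ, 1 ≤ x → (P.intCount x : ℝ) ≤ B * x) : 0 < B := by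
  have h := succ_le_mul_prime P hB 0
  simp only [Nat.cast_zero, zero_add] at h
  by_contra hB0
  have : B * P.prime 0 ≤ 0 := mul_nonpos_of_nonpos_of_nonneg (not_lt.mp hB0) (P.prime_pos 0).le
  linarith

/-- **`∑_j λ_j^{−σ} < ∞` for `σ > 1` when `N_P(x) ≤ Bx`.** [folklore] -/
theorem summable_prime_rpow {B : ℝ} (hB : ∀ x : ℝ, 1 ≤ x → (P.intCount x : ℝ) ≤ B * x)
    {σ : ℝ} (hσ : 1 < σ) : Summable fun j ↦ P.prime j ^ (-σ) := by
  have hB0 := pos_of_intCount_le P hB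
  -- compare with `B^σ (j+1)^{−σ}`
  have hp : Summable fun j : ℕ ↦ B ^ σ * ((j : ℝ) + 1) ^ (-σ) := by
    have h := (Real.summable_nat_rpow (p := -σ)).mpr (by linarith)
    have h' : Summable fun j : ℕ ↦ ((j + 1 : ℕ) : ℝ) ^ (-σ) := (summable_nat_add_iff 1).mpr h
    refine (h'.mul_left (B ^ σ)).congr fun j ↦ ?_
    push_cast; ring_nf
  refine Summable.of_nonneg_of_le (fun j ↦ Real.rpow_nonneg (P.prime_pos j).le _) (fun j ↦ ?_) hp
  have hj : (0 : ℝ) < (j : ℝ) + 1 := by positivity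
  have h1 : ((j : ℝ) + 1) / B ≤ P.prime j := by
    rw [div_le_iff₀ hB0]; linarith [succ_le_mul_prime P hB j]
  calc P.prime j ^ (-σ) ≤ (((j : ℝ) + 1) / B) ^ (-σ) :=
        Real.rpow_le_rpow_of_nonpos (by positivity) h1 (by linarith)
    _ = B ^ σ * ((j : ℝ) + 1) ^ (-σ) := by
        rw [Real.div_rpow hj.le hB0.le, Real.rpow_neg hB0.le, div_inv_eq_mul, mul_comm]

/-- From `|N_P(x) − ax| ≤ Cx^θ` (`x ≥ 1`, `θ ≤ 1`): `N_P(x) ≤ (a + C)x`. [folklore] -/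
theorem intCount_le_of_abs_le {a C θ : ℝ} (hθ : θ ≤ 1)
    (hN : ∀ x : ℝ, 1 ≤ x → |(P.intCount x : ℝ) - a * x| ≤ C * x ^ θ) :
    ∀ x : ℝ, 1 ≤ x → (P.intCount x : ℝ) ≤ (a + C) * x := by
  intro x hx
  have h := hN x hx
  have hC : 0 ≤ C := by
    have := (abs_nonneg _).trans h
    exact nonneg_of_mul_nonneg_left this (Real.rpow_pos_of_pos (by linarith) θ)
  have hxθ : x ^ θ ≤ x := by
    calc x ^ θ ≤ x ^ (1 : ℝ) := Real.rpow_le_rpow_of_exponent_le hx hθ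
      _ = x := Real.rpow_one x
  have := (abs_le.mp h).2
  nlinarith

/-- **`∑_{(j,m)} log λ_j · λ_j^{−(m+1)σ} < ∞` for `σ > 1` when `N_P(x) ≤ Bx`** (the Dirichlet
series of `−ζ_P'/ζ_P` converges absolutely for `Re s > 1`). [folklore] -/
theorem summable_primePow_rpow {B : ℝ} (hB : ∀ x : ℝ, 1 ≤ x → (P.intCount x : ℝ) ≤ B * x)
    {σ : ℝ} (hσ : 1 < σ) :
    Summable fun jm : ℕ × ℕ ↦ Real.log (P.prime jm.1) * P.prime jm.1 ^ (-((jm.2 + 1 : ℕ) * σ)) := by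
  have hnn : 0 ≤ fun jm : ℕ × ℕ ↦ Real.log (P.prime jm.1) * P.prime jm.1 ^ (-((jm.2 + 1 : ℕ) * σ)) :=
    fun jm ↦ mul_nonneg (Real.log_pos (P.one_lt_prime _)).le (Real.rpow_nonneg (P.prime_pos _).le _)
  rw [summable_prod_of_nonneg hnn]
  -- `q_j := λ_j^{−σ} ∈ (0, q₀]`, `q₀ := λ₀^{−σ} < 1`
  set q₀ : ℝ := P.prime 0 ^ (-σ) with hq₀
  have hq₀1 : q₀ < 1 := Real.rpow_lt_one_of_one_lt_of_neg P.one_lt (by linarith)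
  have hq : ∀ j, P.prime j ^ (-σ) ≤ q₀ := fun j ↦
    Real.rpow_le_rpow_of_nonpos (P.prime_pos 0) (P.mono (Nat.zero_le j)) (by linarith)
  have hqpos : ∀ j, 0 < P.prime j ^ (-σ) := fun j ↦ Real.rpow_pos_of_pos (P.prime_pos j) _
  have hterm : ∀ j m, P.prime j ^ (-((m + 1 : ℕ) * σ)) = P.prime j ^ (-σ) * (P.prime j ^ (-σ)) ^ m := by
    intro j m
    rw [← Real.rpow_natCast, ← Real.rpow_mul (P.prime_pos j).le, ← Real.rpow_add (P.prime_pos j)]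
    congr 1; push_cast; ring
  have hgeom : ∀ j, HasSum (fun m : ℕ ↦ Real.log (P.prime j) * P.prime j ^ (-((m + 1 : ℕ) * σ)))
      (Real.log (P.prime j) * (P.prime j ^ (-σ) * (1 - P.prime j ^ (-σ))⁻¹)) := by
    intro j
    simp_rw [hterm j]
    refine HasSum.mul_left _ (HasSum.mul_left _ ?_)
    exact hasSum_geometric_of_lt_one (hqpos j).le ((hq j).trans_lt hq₀1)
  refine ⟨fun j ↦ (hgeom j).summable, ?_⟩
  simp_rw [fun j ↦ (hgeom j).tsum_eq]
  -- `log λ_j ≤ λ_j^{η}/η` with `η = (σ − 1)/2`, so the `j`-th term is `≤ λ_j^{−(σ−η)} /(η(1−q₀))`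
  set η : ℝ := (σ - 1) / 2 with hη
  have hη0 : 0 < η := by rw [hη]; linarith
  have hs := summable_prime_rpow P hB (σ := σ - η) (by rw [hη]; linarith)
  refine Summable.of_nonneg_of_le (fun j ↦ ?_) (fun j ↦ ?_) ((hs.mul_left (η⁻¹ * (1 - q₀)⁻¹)))
  · exact mul_nonneg (Real.log_pos (P.one_lt_prime j)).le
      (mul_nonneg (hqpos j).le (inv_nonneg.mpr (by linarith [hq j])))
  · have hlog : Real.log (P.prime j) ≤ P.prime j ^ η / η := Real.log_le_rpow_div (P.prime_pos j).le hη0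
    have h1 : (1 - P.prime j ^ (-σ))⁻¹ ≤ (1 - q₀)⁻¹ :=
      inv_anti₀ (by linarith) (by linarith [hq j])
    have hpow : P.prime j ^ η * P.prime j ^ (-σ) = P.prime j ^ (-(σ - η)) := by
      rw [← Real.rpow_add (P.prime_pos j)]; congr 1; ring
    have hA : P.prime j ^ (-σ) * (1 - P.prime j ^ (-σ))⁻¹ ≤ P.prime j ^ (-σ) * (1 - q₀)⁻¹ :=
      mul_le_mul_of_nonneg_left h1 (hqpos j).le
    have hB' : 0 ≤ P.prime j ^ (-σ) * (1 - P.prime j ^ (-σ))⁻¹ :=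
      mul_nonneg (hqpos j).le (inv_nonneg.mpr (by linarith [hq j]))
    have hC : 0 ≤ P.prime j ^ η / η := div_nonneg (Real.rpow_nonneg (P.prime_pos j).le _) hη0.le
    calc Real.log (P.prime j) * (P.prime j ^ (-σ) * (1 - P.prime j ^ (-σ))⁻¹)
        ≤ (P.prime j ^ η / η) * (P.prime j ^ (-σ) * (1 - q₀)⁻¹) := mul_le_mul hlog hA hB' hC
      _ = η⁻¹ * (1 - q₀)⁻¹ * P.prime j ^ (-(σ - η)) := by rw [← hpow]; ring

end Hilberdink

end Literature.NumberTheory.BeurlingPrimes
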